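import Literature.NumberTheory.Automorphic.ArithmeticQuotientCohomologyFiniteProofs
import Literature.NumberTheory.NumberFields.CongruenceSubgroupTorsionFree
import Literature.Algebra.Homology.GroupCohomologyFiniteIndexModuleFinite
import Literature.Algebra.Homology.GroupCohomologyFiniteTypeResolution
import HarnessLib

/-!
# Finite-dimensionality of the cohomology of congruence subgroups of `GL_n` over a number field
# (Borel–Serre), field coefficients

Topic `NumberTheory/Automorphic`; namespace `Literature.NumberTheory.Automorphic`.  ONE NAMED FACT
(`def … : Prop`, D-0014) and its reduction to the published source theorem taken as an explicit
hypothesis (theorems); no instance, no `sorry`.  Third sibling of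

* `BorelSerre1973_finiteDimensional_groupCohomology` (`ArithmeticGroupCohomologyFiniteness`):
  subgroups of finite index of `GL_n(ℤ)`, coefficients a finite-dimensional representation over a
  FIELD, conclusion finite-dimensional;
* `BorelSerre1973_finite_groupCohomology_congruenceSubgroup` (`ArithmeticQuotientCohomologyFinite`):
  congruence subgroups `Γ_U = GL_n(K) ∩ U` of `GL_n` over a NUMBER FIELD, FINITE coefficients,
  conclusion finite;

namely the combination the Betti receptacles with algebraic coefficients need
(`ResGLnCohomology.levelCohomology ℂ n K 𝔫 λ q`, through Shapiro's lemma over the finitely many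
components, `BigHeckeGLn.exists_finset_orbit_cover` and
`TwistedQuotient.moduleFinite_cohomology_of_finite_cover`):

* `BorelSerre1973_finiteDimensional_groupCohomology_congruenceSubgroup` — for a field `k`, a number
  field `K`, `n ≥ 0`, a compact open `U ≤ GL_n(𝔸_K^∞)` and a finite-dimensional `k`-linear
  representation `A` of `Γ_U = GL_n(K) ∩ U` (`U.comap (globalEmbedding n K)`), every
  `H^q(Γ_U, A) = groupCohomology A q` is finite-dimensional over `k`.

Neither sibling implies it formally (`GL_n(𝓞_K)` has infinite index in `GL_{n[K:ℚ]}(ℤ)` for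
`K ≠ ℚ`; finite coefficients say nothing about `ℂ`-coefficients), but the printed source and proof
are the same: `Γ_U` is an arithmetic subgroup of `R_{K/ℚ} GL_n` [BorelSerre1973, 11.6], hence of
type (WFL) [BorelSerre1973, Thm. 11.4.4 with §11.1 (c)] = [Serre1971CohomologieGroupesDiscrets,
§2.4 Th. 4 (a)], in particular of type `FP_∞` over any field, so `H^q(Γ_U, A)` is finitely
generated over `k` for `A` finitely generated [Brown1982CohomologyGroups, VIII (5.1), VIII.4 Ex. 1],
[Serre1971CohomologieGroupesDiscrets, §1.8 Remarque].  As for the siblings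
(`ArithmeticGroupCohomologyFinitenessProofs`, `ArithmeticQuotientCohomologyFiniteProofs`) the fact
is PROVED here from the geometric apex kept as an explicit hypothesis (not a named fact, D-0026):

* `…_of_glIntegers` — from "`GL_n(𝓞_K)` has a finite-index subgroup `Γ'` such that the trivial
  `k[Γ']`-module `k` has a projective resolution by free `k[Γ']`-modules of finite rank" (every
  field `k`): finite-type resolution ⟹ `H^q(Γ', -)` finitely generated on finitely generated
  coefficients (`moduleFinite_groupCohomology_of_finiteType_resolution`) ⟹ the same for
  `GL_n(𝓞_K)` (ascent, `moduleFinite_groupCohomology_of_finiteIndex`) ⟹ for its isomorphic image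
  `GL_n(K) ∩ GL_n(𝒪̂_K)` (`moduleFinite_groupCohomology_of_mulEquiv`,
  `BigHeckeGLn.map_algebraMap_ringOfIntegers_injective`) ⟹ for the commensurable `Γ_U`
  (`commensurable_comap_globalEmbedding_glIntegers`, `moduleFinite_groupCohomology_of_commensurable`);
* `…_of_typeFL_torsionFree` — from [BorelSerre1973, §11.1 (c)] AS PRINTED (every torsion-free
  subgroup of finite index of `GL_n(𝓞_K)` is of type (FL), resolution form over the field `k`),
  Minkowski's lemma (`NumberFields.GeneralLinearGroup.exists_finiteIndex_forall_isOfFinOrder_eq_one`)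
  supplying the torsion-free subgroup of finite index.

## References

* A. Borel, J.-P. Serre, *Corners and arithmetic groups*, Comment. Math. Helv. 48 (1973), §11.1 (c),
  Thm. 11.4.4, 11.6. [BorelSerre1973]
* J.-P. Serre, *Cohomologie des groupes discrets*, Ann. of Math. Studies 70 (1971), §1.8, §2.4 Th. 4.
  [Serre1971CohomologieGroupesDiscrets]
* K. S. Brown, *Cohomology of Groups*, GTM 87 (1982), III (6.2), VIII (5.1), VIII.4 Ex. 1.
  [Brown1982CohomologyGroups]
-/

noncomputable section

open CategoryTheory NumberField IsDedekindDomain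
open scoped MatrixGroups

namespace Literature.NumberTheory.Automorphic

open Literature.Algebra.Homology BigHeckeGLn

/-! ### The named fact -/

/-- NAMED FACT — **the cohomology of a congruence subgroup of `GL_n` over a number field with
coefficients in a finite-dimensional representation over a field is finite-dimensional**
(Borel–Serre).  For a field `k`, `n ≥ 0`, a number field `K`, a compact open subgroup
`U ≤ GL_n(𝔸_K^∞)` and the congruence subgroup `Γ_U = GL_n(K) ∩ U` (`U.comap (globalEmbedding n K)`,
an arithmetic subgroup of `R_{K/ℚ} GL_n`, commensurable with `GL_n(𝓞_K)`): for every
`A : Rep k Γ_U` finite-dimensional over `k` and every `q`, Mathlib's `groupCohomology A q` is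
finite-dimensional over `k`.  Printed: arithmetic subgroups of reductive `ℚ`-groups (here
`R_{K/ℚ} GL_n`, 11.6) are of type (WFL) [cite: BorelSerre1973, §11.1 (c), Thm. 11.4.4, 11.6]
[cite: Serre1971CohomologieGroupesDiscrets, §2.4 Th. 4 (a); §1.8 Remarque], hence of type `FP_∞`
over every field, so `H^q(Γ_U, A)` is finitely generated for finitely generated `A`
[cite: Brown1982CohomologyGroups, VIII (5.1); VIII.4 Exercise 1].  Siblings:
`BorelSerre1973_finiteDimensional_groupCohomology` (`GL_n(ℤ)`),
`BorelSerre1973_finite_groupCohomology_congruenceSubgroup` (finite coefficients).  Unproved in the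
tree (reduced below to §11.1 (c) as printed); users take
`(h : BorelSerre1973_finiteDimensional_groupCohomology_congruenceSubgroup)`. -/
def BorelSerre1973_finiteDimensional_groupCohomology_congruenceSubgroup : Prop :=
  ∀ (k : Type) [Field k] (n : ℕ) (K : Type) [Field K] [NumberField K]
    (U : Subgroup (FiniteAdelicGL n K)),
    IsOpen (U : Set (FiniteAdelicGL n K)) → IsCompact (U : Set (FiniteAdelicGL n K)) →
    ∀ (A : Rep k (U.comap (globalEmbedding n K))), Module.Finite k A →
      ∀ q : ℕ, Module.Finite k (groupCohomology A q)

/-! ### Reduction to the source theorem (explicit hypothesis, D-0026) -/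

/-- **The fact from "`GL_n(𝓞_K)` is virtually of type (FL) over `k`".**  If for every field `k`,
every number field `K` and every `n` the arithmetic group `GL_n(𝓞_K)` (Mathlib `GL (Fin n) (𝓞 K)`)
has a subgroup `Γ'` of finite index such that the trivial `k[Γ']`-module `k` admits a projective
resolution by free `k[Γ']`-modules of finite rank — [BorelSerre1973, Thm. 11.4.4 with 11.1 (c),
11.6]: `GL_n(𝓞_K)` is of type (WFL), in particular (VFL) — then
`BorelSerre1973_finiteDimensional_groupCohomology_congruenceSubgroup` holds.  Chain: finite-type
resolution ⟹ `H^q(Γ', -)` finitely generated on finitely generated coefficients ⟹ the same for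
`GL_n(𝓞_K)` (ascent) ⟹ for its isomorphic image `GL_n(K) ∩ GL_n(𝒪̂_K)` (transport) ⟹ for the
commensurable `Γ_U` (`commensurable_comap_globalEmbedding_glIntegers`).
[cite: BorelSerre1973, §11.1 (c), Thm. 11.4.4, 11.6]
[cite: Brown1982CohomologyGroups, III (6.2), VIII (5.1), VIII.4 Exercise 1] -/
theorem BorelSerre1973_finiteDimensional_groupCohomology_congruenceSubgroup_of_glIntegers
    (h : ∀ (k : Type) [Field k] (n : ℕ) (K : Type) [Field K] [NumberField K],
      ∃ Γ' : Subgroup (GL (Fin n) (𝓞 K)), Γ'.FiniteIndex ∧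
        ∃ P : ProjectiveResolution (Rep.trivial k Γ' k),
          ∀ i, ∃ m : ℕ, Nonempty (P.complex.X i ≅ Rep.free k Γ' (Fin m))) :
    BorelSerre1973_finiteDimensional_groupCohomology_congruenceSubgroup := by
  intro k _ n K _ _ U hUo hUc A hA q
  obtain ⟨Γ', hΓ', P, hP⟩ := h k n K
  -- finitely generated cohomology on finitely generated coefficients for `GL_n(𝓞_K)`: ascent
  have h₀ : ∀ (B : Rep k (GL (Fin n) (𝓞 K))), Module.Finite k B → ∀ m,
      Module.Finite k (groupCohomology B m) :=
    fun B hB m => moduleFinite_groupCohomology_of_finiteIndex Γ'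
      (fun C hC m' => by
        haveI := hC
        exact moduleFinite_groupCohomology_of_finiteType_resolution P hP C m') m B hB
  -- transport to the image `GL_n(K) ∩ GL_n(𝒪̂_K)` of `GL_n(𝓞_K)` in `GL_n(K)`
  have h₁ : ∀ (B : Rep k (Matrix.GeneralLinearGroup.map (algebraMap (𝓞 K) K) :
      GL (Fin n) (𝓞 K) →* GL (Fin n) K).range), Module.Finite k B → ∀ m,
      Module.Finite k (groupCohomology B m) :=
    fun B hB m => by
      haveI := hB
      exact moduleFinite_groupCohomology_of_mulEquiv
        (MonoidHom.ofInjective (map_algebraMap_ringOfIntegers_injective n K)) h₀ B m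
  -- `Γ_U` is commensurable with it
  have hc := commensurable_comap_globalEmbedding_glIntegers U hUo hUc
  haveI : ((U.comap (globalEmbedding n K)).subgroupOf (Matrix.GeneralLinearGroup.map
      (algebraMap (𝓞 K) K) : GL (Fin n) (𝓞 K) →* GL (Fin n) K).range).FiniteIndex := ⟨hc.1⟩
  haveI : ((Matrix.GeneralLinearGroup.map (algebraMap (𝓞 K) K) :
      GL (Fin n) (𝓞 K) →* GL (Fin n) K).range.subgroupOf
        (U.comap (globalEmbedding n K))).FiniteIndex := ⟨hc.2⟩
  haveI := hA
  exact moduleFinite_groupCohomology_of_commensurable _ _ h₁ A q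

/-- **The fact from §11.1 (c) as printed: "torsion-free arithmetic groups are of type (FL)"**,
read with coefficients in the field `k` (the simplicial chains of a `Γ'`-invariant triangulation of
the contractible bordification `X̄` — finitely many cells modulo `Γ'` — with coefficients in `k`
resolve `k` by free `k[Γ']`-modules of finite rank).  If this holds for every torsion-free subgroup
`Γ'` of finite index of every `GL_n(𝓞_K)`, then
`BorelSerre1973_finiteDimensional_groupCohomology_congruenceSubgroup` holds: `GL_n(𝓞_K)` has a
torsion-free subgroup of finite index (Minkowski, `Γ(3)`-type:
`NumberFields.GeneralLinearGroup.exists_finiteIndex_forall_isOfFinOrder_eq_one`), and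
`…_of_glIntegers` applies — Thm. 11.4.4's own proof with the geometric input kept explicit (D-0026).
[cite: BorelSerre1973, §11.1 (c), Thm. 11.4.4 (proof), 11.6]
[cite: Serre1971CohomologieGroupesDiscrets, §1.8 (Minkowski; Déf. (WFL)); §2.4 Th. 4 (a)] -/
theorem BorelSerre1973_finiteDimensional_groupCohomology_congruenceSubgroup_of_typeFL_torsionFree
    (h : ∀ (k : Type) [Field k] (n : ℕ) (K : Type) [Field K] [NumberField K]
      (Γ' : Subgroup (GL (Fin n) (𝓞 K))), Γ'.FiniteIndex → (∀ g : Γ', IsOfFinOrder g → g = 1) →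
      ∃ P : ProjectiveResolution (Rep.trivial k Γ' k),
        ∀ i, ∃ m : ℕ, Nonempty (P.complex.X i ≅ Rep.free k Γ' (Fin m))) :
    BorelSerre1973_finiteDimensional_groupCohomology_congruenceSubgroup :=
  BorelSerre1973_finiteDimensional_groupCohomology_congruenceSubgroup_of_glIntegers
    fun k _ n K _ _ => by
      obtain ⟨Γ', hΓ', htf⟩ :=
        NumberFields.GeneralLinearGroup.exists_finiteIndex_forall_isOfFinOrder_eq_one K (n := Fin n)
      exact ⟨Γ', hΓ', h k n K Γ' hΓ' htf⟩

end Literature.NumberTheory.Automorphic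

end
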